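import Mathlib
import HarnessLib
import Summits.NavierStokesRegularity.NavierStokesRegularity.Theses.SymmetryModuliCount
import Literature.Analysis.FluidPDE.TypeIAncientMildClassical
import Literature.Analysis.FluidPDE.ClassicalLocalEnergyCutoff
import Literature.Analysis.FluidPDE.PressurePoisson
import Literature.Analysis.FluidPDE.KNSSTypeIRateMildProofs
import Summits.NavierStokesRegularity.NavierStokesRegularity.Theorems.SymmetryModuliCountFarPastLedgerCovering
import Summits.NavierStokesRegularity.NavierStokesRegularity.Theorems.SymmetryModuliCountFarPastLedgerFarShell

/-!
# Line `uloc-gronwall-transplant` — crux `SymmetryModuliCount.FarPastLedger`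
  (stmt-NavierStokesRegularity-14060), LEAD SKELETON (unit-scale reshaping)

The crux: `∀ C ∃ K ∀ u ∈ A_C ∀ t < 0 ∀ x₀ ∀ R > 0, ∫_{B_R(x₀)} ‖u(t)‖² ≤ K R`
(`A_C = IsTypeIAncientMild C`: jointly smooth on `t < 0`, divergence free, KNSS/Oseen mild between
all pairs of negative times, `‖u(t,x)‖ ≤ C/√(−t)`).

## Shape (card `Ideas/uloc-gronwall-transplant.md`, reshaped by the lead to UNIT SCALE)

0. **Reduction** (proved here, adapted from the disprover's `Cruxes/FarPastLedger/Disproof.lean`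
   §6): `A_C` is invariant under `u ↦ c u(c²t, cx)` and under spatial translations, and the
   ledger scales exactly, so the crux is equivalent to
   `∀ C ∃ K ∀ u ∈ A_C ∀ t ∈ (−1, 0), ∫_{B₁(0)} ‖u(t)‖² ≤ K` (`crux_of_unitWindow`); for
   `t ≤ −1` the unit ball is in the parabolic interior.
1. **Pressure block** (stubs GRADP, MD, HA, PIN; composition `nearFar_window` proved here): the
   abstract classical pressure `p` of `u` on a window `(t₀, 0)`
   (`IsTypeIAncientMild.exists_isClassicalNSSolutionOn_Ioo`, Fabes–Jones–Rivière) has, on every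
   ball `B₂(x₀)` and at every window time `τ`, the near/far structure `p(τ) = c + p₁ + p₂`,
   `‖p₁‖₂² ≤ c₀ (C²/(−τ)) ∫_{B₄(x₀)}‖u(τ)‖²`, `‖∇p₂‖ ≤ c₀ ∫_{|y−x₀|≥3} ‖u(τ,y)‖² |y−x₀|⁻⁴` on `B₂(x₀)`.
   HA (slice harmonic analysis, the lead's stub): ANY smooth `q` with `Δq = −∂ᵢ∂ⱼ(wᵢwⱼ)`,
   `∇q` bounded, `w` bounded smooth divergence free, has this structure modulo an affine mode
   `⟪a, x⟫`, and `a` is the large-scale average of `∇q` up to `O(M²/r)`. GRADP: `∇p(τ,·)` is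
   bounded (KNSS smoothing, tree `knss2009_smoothing_holds`). MD (the ONLY use of the Oseen
   identity H3): the bump-averaged displacement `r⁻³∫θ(x/r)(u(t₂,x) − u(t₁,x))dx → 0`.
   PIN: averaging the momentum equation at scale `r → ∞` then shows `∫_{t₁}^{t₂} a = 0`, so
   `a ≡ 0` (continuity from the uniform rate).
2. **Ledger block** (stubs COV, SHELL, LFL): the tree's local energy identity against a
   time-independent cut-off (`IsClassicalNSSolutionOn.local_energy_identity_cutoff`) on
   `B₂(x₀)` between window times `s' ≤ t'`, dissipation dropped, every flux linear in a
   majorant `B` of the unit-ball energies on `[s', t']` with ONE factor spent on the Type-I rate: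
   `∫_{B₁(x₀)}‖u(t')‖² ≤ N F₀ + N B ((t'−s') + C(√(−s') − √(−t')))` (LFL), using the covering
   count `∫_{B_ρ} ≤ 125ρ³ sup_z ∫_{B₁(z)}` (COV) and the far-shell sum (SHELL).
3. **Closure** (proved here, `unitWindow_of_ledger`): a DOUBLING Grönwall over a uniform
   partition of `[−1, t]` (no measurability, no exponent bootstrap): with `h + C√h ≤ 1/(2N)`,
   the sup of the unit-ball energies at most doubles·N per step, `K(C) = (2N)^{n+1} C² |B₁|`-type.

Registered stubs are stated over tree declarations only (fully inlined signatures), so that a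
Theorems file can restate and prove each by name without importing this module; the `def`s are
readable aliases, definitionally the inlined clauses.

Disproof used (`Cruxes/FarPastLedger/Disproof.lean` v2): §6 reductions (re-proved below);
§5a `farPastLedger_false_without_mild` — H3 enters exactly at MD (pressure pinning); §5b
`_false_without_typeI` — the rate enters at the entry deposit and the crossing number
`∫_{s'}^{t'} C(−τ)^{-1/2} ≤ 2C`; `_false_on_window` — ancientness = the entry time `−1` of the unit
window exists after rescaling every `(t, R)`; §6 exponent rigidity honoured (no `R^a` ledger).
No `-- Targets` kill, no landed `Negative/` lemma at the time of writing.
-/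

set_option linter.dupNamespace false

noncomputable section

namespace Summit.NavierStokesRegularity.NavierStokesRegularity.Cruxes.FarPastLedger.UlocGronwallTransplant

open MeasureTheory Set Filter Metric Topology
open scoped Laplacian
open Literature.Analysis.FluidPDE Literature.Analysis.UnboundedOperators

local notation "ℝ³" => EuclideanSpace ℝ (Fin 3)

/-! ## Readable aliases (definitionally the inlined stub clauses) -/

/-- The fixed bump `θ`: Mathlib's smooth bump at the origin with `θ = 1` on `B̄₁`, `supp θ = B₂`,
`0 ≤ θ ≤ 1`. Large-scale averages are taken against `θ(x/r)`. -/
def bump : ℝ³ → ℝ := (⟨1, 2, zero_lt_one, one_lt_two⟩ : ContDiffBump (0 : ℝ³))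

/-- COVERING COUNT: a ball of radius `ρ ≥ 1` costs at most `125 ρ³` unit balls. -/
def CoveringCount : Prop :=
  ∀ (ρ : ℝ), 1 ≤ ρ → ∀ (g : ℝ³ → ℝ), Continuous g → (∀ x, 0 ≤ g x) → ∀ (B : ℝ) (x₁ : ℝ³),
    (∀ z : ℝ³, ∫ x in ball z 1, g x ≤ B) → ∫ x in ball x₁ ρ, g x ≤ 125 * ρ ^ 3 * B

/-- FAR-SHELL SUM with constant `cS`: `∫_{|y−x₁|≥3} g |y−x₁|⁻⁴ ≤ cS · sup_z ∫_{B₁(z)} g`. -/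
def FarShellBound (cS : ℝ) : Prop :=
  ∀ (g : ℝ³ → ℝ), Continuous g → (∀ x, 0 ≤ g x) → (∃ M : ℝ, ∀ x, g x ≤ M) → ∀ (B : ℝ) (x₁ : ℝ³),
    (∀ z : ℝ³, ∫ x in ball z 1, g x ≤ B) →
      IntegrableOn (fun y => g y / ‖y - x₁‖ ^ 4) (ball x₁ 3)ᶜ volume ∧
        ∫ y in (ball x₁ 3)ᶜ, g y / ‖y - x₁‖ ^ 4 ≤ cS * B

/-- NEAR/FAR STRUCTURE of a pressure `p` of `u` on the window `(t₀, 0)` at unit scale, constant `c₀`. -/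
def NearFar (c₀ C : ℝ) (u : ℝ → ℝ³ → ℝ³) (p : ℝ → ℝ³ → ℝ) (t₀ : ℝ) : Prop :=
  ∀ τ ∈ Ioo t₀ 0, ∀ x₀ : ℝ³, ∃ (c : ℝ) (p₁ p₂ : ℝ³ → ℝ),
    (∀ x ∈ ball x₀ 2, p τ x = c + p₁ x + p₂ x) ∧ MemLp p₁ 2 volume ∧
      ∫ x, p₁ x ^ 2 ≤ c₀ * (C ^ 2 / (-τ)) * ∫ x in ball x₀ 4, ‖u τ x‖ ^ 2 ∧
        ∀ x ∈ ball x₀ 2, DifferentiableAt ℝ p₂ x ∧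
          ‖fderiv ℝ p₂ x‖ ≤ c₀ * ∫ y in (ball x₀ 3)ᶜ, ‖u τ y‖ ^ 2 / ‖y - x₀‖ ^ 4

/-- MEAN DISPLACEMENT VANISHES for the field `u`: `r⁻³ ∫ θ(x/r)(u(t₂,x) − u(t₁,x)) dx → 0`. -/
def MeanDisplacementVanishes (u : ℝ → ℝ³ → ℝ³) : Prop :=
  ∀ t₁ t₂ : ℝ, t₁ < t₂ → t₂ < 0 →
    Tendsto (fun r : ℝ => (r ^ 3)⁻¹ • ∫ x, (bump (r⁻¹ • x)) • (u t₂ x - u t₁ x)) atTop (𝓝 0)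

/-- The unit-window form of the crux. -/
def UnitWindowLedger : Prop :=
  ∀ C : ℝ, ∃ K : ℝ, ∀ (u : ℝ → ℝ³ → ℝ³), IsTypeIAncientMild C u → ∀ t ∈ Ioo (-1 : ℝ) 0,
    ∫ x in ball (0 : ℝ³) 1, ‖u t x‖ ^ 2 ≤ K

/-! ## Registered stubs (signatures over tree declarations only) -/

/-- stub COV `stub_fplCovering` (S): the covering count. Unit cubes centred on `x₁ + ℤ³` have
circumradius `√3/2 < 1`; at most `(2ρ+3)³ ≤ 125ρ³` of them meet `B_ρ(x₁)` (`ρ ≥ 1`). -/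
theorem stub_fplCovering :
    ∀ (ρ : ℝ), 1 ≤ ρ → ∀ (g : EuclideanSpace ℝ (Fin 3) → ℝ), Continuous g → (∀ x, 0 ≤ g x) →
    ∀ (B : ℝ) (x₁ : EuclideanSpace ℝ (Fin 3)),
    (∀ z : EuclideanSpace ℝ (Fin 3), ∫ x in Metric.ball z 1, g x ≤ B) →
    ∫ x in Metric.ball x₁ ρ, g x ≤ 125 * ρ ^ 3 * B :=
  Summit.NavierStokesRegularity.NavierStokesRegularity.Theorems.stub_fplCovering

/-- stub SHELL `stub_fplFarShell` (S): dyadic shells `3·2ᵏ ≤ |y−x₁| < 3·2ᵏ⁺¹`, each covered by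
`125 (3·2ᵏ⁺¹)³` unit balls, weights `(3·2ᵏ)⁻⁴`: a geometric series. Takes COV as hypothesis. -/
theorem stub_fplFarShell :
    ∃ cS : ℝ, 0 ≤ cS ∧
    ((∀ (ρ : ℝ), 1 ≤ ρ → ∀ (g : EuclideanSpace ℝ (Fin 3) → ℝ), Continuous g → (∀ x, 0 ≤ g x) →
      ∀ (B : ℝ) (x₁ : EuclideanSpace ℝ (Fin 3)),
      (∀ z : EuclideanSpace ℝ (Fin 3), ∫ x in Metric.ball z 1, g x ≤ B) →
      ∫ x in Metric.ball x₁ ρ, g x ≤ 125 * ρ ^ 3 * B) →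
    ∀ (g : EuclideanSpace ℝ (Fin 3) → ℝ), Continuous g → (∀ x, 0 ≤ g x) → (∃ M : ℝ, ∀ x, g x ≤ M) →
    ∀ (B : ℝ) (x₁ : EuclideanSpace ℝ (Fin 3)),
    (∀ z : EuclideanSpace ℝ (Fin 3), ∫ x in Metric.ball z 1, g x ≤ B) →
      MeasureTheory.IntegrableOn (fun y => g y / ‖y - x₁‖ ^ 4) (Metric.ball x₁ 3)ᶜ
          MeasureTheory.volume ∧
        ∫ y in (Metric.ball x₁ 3)ᶜ, g y / ‖y - x₁‖ ^ 4 ≤ cS * B) :=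
  Summit.NavierStokesRegularity.NavierStokesRegularity.Theorems.stub_fplFarShell

/-- stub LFL `stub_fplLinearFluxLedger` (M, THE LEVER): the local energy identity of the classical
pair on the open window (`IsClassicalNSSolutionOn.local_energy_identity_cutoff`, cut-off `= 1` on
`B₁(x₀)`, supported in `B₂(x₀)`), dissipation dropped, fluxes `|u|²|Δφ|`, `|u|³|∇φ|`,
`2|p−c||u||∇φ|` bounded linearly in the majorant `B` with one factor `‖u(τ)‖_∞ ≤ C/√(−τ)`
(near pressure by Cauchy–Schwarz, far pressure by the gradient bound × diameter), then
`∫_{s'}^{t'} (A + A'C(−τ)^{-1/2}) dτ = A(t'−s') + 2A'C(√(−s') − √(−t'))`. COV and SHELL enter as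
hypotheses. -/
theorem stub_fplLinearFluxLedger :
    ∀ (c₀ cS : ℝ), ∃ N : ℝ, 0 ≤ N ∧
    ∀ (C : ℝ) (u : ℝ → EuclideanSpace ℝ (Fin 3) → EuclideanSpace ℝ (Fin 3)),
    Literature.Analysis.FluidPDE.IsTypeIAncientMild C u →
    ∀ (t₀ : ℝ) (p : ℝ → EuclideanSpace ℝ (Fin 3) → ℝ),
    Literature.Analysis.FluidPDE.IsClassicalNSSolutionOn (Set.Ioo t₀ 0) 1 0 u p →
    (∀ τ ∈ Set.Ioo t₀ 0, ∀ x₀ : EuclideanSpace ℝ (Fin 3),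
      ∃ (c : ℝ) (p₁ p₂ : EuclideanSpace ℝ (Fin 3) → ℝ),
      (∀ x ∈ Metric.ball x₀ 2, p τ x = c + p₁ x + p₂ x) ∧
      MeasureTheory.MemLp p₁ 2 MeasureTheory.volume ∧
      ∫ x, p₁ x ^ 2 ≤ c₀ * (C ^ 2 / (-τ)) * ∫ x in Metric.ball x₀ 4, ‖u τ x‖ ^ 2 ∧
      ∀ x ∈ Metric.ball x₀ 2, DifferentiableAt ℝ p₂ x ∧
        ‖fderiv ℝ p₂ x‖ ≤ c₀ * ∫ y in (Metric.ball x₀ 3)ᶜ, ‖u τ y‖ ^ 2 / ‖y - x₀‖ ^ 4) →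
    (∀ (ρ : ℝ), 1 ≤ ρ → ∀ (g : EuclideanSpace ℝ (Fin 3) → ℝ), Continuous g → (∀ x, 0 ≤ g x) →
      ∀ (B : ℝ) (x₁ : EuclideanSpace ℝ (Fin 3)),
      (∀ z : EuclideanSpace ℝ (Fin 3), ∫ x in Metric.ball z 1, g x ≤ B) →
      ∫ x in Metric.ball x₁ ρ, g x ≤ 125 * ρ ^ 3 * B) →
    (∀ (g : EuclideanSpace ℝ (Fin 3) → ℝ), Continuous g → (∀ x, 0 ≤ g x) → (∃ M : ℝ, ∀ x, g x ≤ M) →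
      ∀ (B : ℝ) (x₁ : EuclideanSpace ℝ (Fin 3)),
      (∀ z : EuclideanSpace ℝ (Fin 3), ∫ x in Metric.ball z 1, g x ≤ B) →
      MeasureTheory.IntegrableOn (fun y => g y / ‖y - x₁‖ ^ 4) (Metric.ball x₁ 3)ᶜ
          MeasureTheory.volume ∧
        ∫ y in (Metric.ball x₁ 3)ᶜ, g y / ‖y - x₁‖ ^ 4 ≤ cS * B) →
    ∀ (s' t' : ℝ), t₀ < s' → s' ≤ t' → t' < 0 → ∀ (F₀ B : ℝ), 0 ≤ B →
    (∀ z : EuclideanSpace ℝ (Fin 3), ∫ x in Metric.ball z 1, ‖u s' x‖ ^ 2 ≤ F₀) →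
    (∀ τ ∈ Set.Icc s' t', ∀ z : EuclideanSpace ℝ (Fin 3), ∫ x in Metric.ball z 1, ‖u τ x‖ ^ 2 ≤ B) →
    ∀ x₀ : EuclideanSpace ℝ (Fin 3),
      ∫ x in Metric.ball x₀ 1, ‖u t' x‖ ^ 2 ≤
        N * F₀ + N * B * ((t' - s') + C * (Real.sqrt (-s') - Real.sqrt (-t'))) := by
  sorry

/-- stub GRADP `stub_fplPressureGradientBound` (S–M): on a window the pressure gradient of the
classical pair is bounded in space at each time: `∇p = Δu − (u·∇)u − ∂ₜu` (momentum equation) and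
all space–time derivatives of `u` are bounded on `[τ, τ'] × ℝ³ ⊂ (s, 0) × ℝ³` by KNSS smoothing
(`knss2009_smoothing_holds`, applied to the mild identity from any earlier time `s`, whose
canonical representative IS `u` by `IsTypeIAncientMild.mild_eq_heatExtension`). -/
theorem stub_fplPressureGradientBound :
    ∀ (C : ℝ) (u : ℝ → EuclideanSpace ℝ (Fin 3) → EuclideanSpace ℝ (Fin 3)),
    Literature.Analysis.FluidPDE.IsTypeIAncientMild C u →
    ∀ (t₀ : ℝ) (p : ℝ → EuclideanSpace ℝ (Fin 3) → ℝ),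
    Literature.Analysis.FluidPDE.IsClassicalNSSolutionOn (Set.Ioo t₀ 0) 1 0 u p →
    ∀ τ ∈ Set.Ioo t₀ 0, ∃ L : ℝ, ∀ x : EuclideanSpace ℝ (Fin 3), ‖fderiv ℝ (p τ) x‖ ≤ L := by
  sorry

/-- stub MD `stub_fplMeanDisplacement` (M; the one place the Oseen identity H3 is consumed): the
bump-averaged displacement between two negative times vanishes at large scales. Test the POINTWISE
identity `u(t₂) − u(t₁) = (e^{(t₂−t₁)Δ}u(t₁) − u(t₁)) − B_{t₁}(u,u)(t₂)` against `θ(x/r)`: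
the caloric part is `∫⟪u(t₁), e^{(t₂−t₁)Δ}θ_r − θ_r⟫ = O(‖u‖_∞ (t₂−t₁) ‖Δθ_r‖₁) = O(r)`, the
Duhamel part is `O(‖u‖²_∞ r² log r)` after moving the divergence in the Oseen kernel onto `θ_r`
(kernel of `e^{σΔ}ℙ` is `O((√σ+|z|)⁻³)`); both are `o(r³)`. -/
theorem stub_fplMeanDisplacement :
    ∀ (C : ℝ) (u : ℝ → EuclideanSpace ℝ (Fin 3) → EuclideanSpace ℝ (Fin 3)),
    Literature.Analysis.FluidPDE.IsTypeIAncientMild C u →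
    ∀ t₁ t₂ : ℝ, t₁ < t₂ → t₂ < 0 →
    Filter.Tendsto (fun r : ℝ => (r ^ 3)⁻¹ •
      ∫ x, (((⟨1, 2, zero_lt_one, one_lt_two⟩ : ContDiffBump (0 : EuclideanSpace ℝ (Fin 3))) :
          EuclideanSpace ℝ (Fin 3) → ℝ) (r⁻¹ • x)) • (u t₂ x - u t₁ x))
      Filter.atTop (nhds 0) := by
  sorry

/-- stub HA `stub_fplSlicePressure` (L, the lead's): SLICE HARMONIC ANALYSIS. For `w` smooth,
bounded by `M`, divergence free, and `q` smooth with `‖∇q‖ ≤ L` and `Δq = −div((w·∇)w)`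
(`= −∂ᵢ∂ⱼ(wᵢwⱼ)`), there is a constant vector `a` such that on EVERY ball `B₂(x₀)`,
`q = c + ⟪a, ·⟫ + p₁ + p₂` with `‖p₁‖₂² ≤ c₀ M² ∫_{B₄(x₀)}‖w‖²` (`p₁` = Riesz pressure of the
cut-off field, Plancherel/Stein L² bound) and `‖∇p₂‖ ≤ c₀ ∫_{|y−x₀|≥3}‖w‖²|y−x₀|⁻⁴` on `B₂(x₀)`
(far part: Newtonian representation of the Riesz pressure of the truncated far field off its
support, limit of truncations; remainder harmonic on huge balls with `o(ρ²)` mean oscillation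
because `∇q` is bounded ⇒ affine), and `a` is the large-scale bump average of `∇q` up to
`c₀M²/r` (near part by parts against `∇θ_r` in `L²`, far part pointwise). -/
theorem stub_fplSlicePressure :
    ∃ c₀ : ℝ, 0 ≤ c₀ ∧
    ∀ (M L : ℝ) (w : EuclideanSpace ℝ (Fin 3) → EuclideanSpace ℝ (Fin 3))
      (q : EuclideanSpace ℝ (Fin 3) → ℝ),
    ContDiff ℝ (⊤ : ℕ∞) w → ContDiff ℝ (⊤ : ℕ∞) q →
    Literature.Analysis.FluidPDE.VectorCalculus.IsDivFree w →
    (∀ x, ‖w x‖ ≤ M) → (∀ x, ‖fderiv ℝ q x‖ ≤ L) →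
    (∀ x, Laplacian.laplacian q x =
      -Literature.Analysis.FluidPDE.VectorCalculus.divergence
        (Literature.Analysis.FluidPDE.convect w w) x) →
    ∃ a : EuclideanSpace ℝ (Fin 3),
      (∀ x₀ : EuclideanSpace ℝ (Fin 3), ∃ (c : ℝ) (p₁ p₂ : EuclideanSpace ℝ (Fin 3) → ℝ),
        (∀ x ∈ Metric.ball x₀ 2, q x = c + inner ℝ a x + p₁ x + p₂ x) ∧
        MeasureTheory.MemLp p₁ 2 MeasureTheory.volume ∧
        ∫ x, p₁ x ^ 2 ≤ c₀ * M ^ 2 * ∫ x in Metric.ball x₀ 4, ‖w x‖ ^ 2 ∧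
        ∀ x ∈ Metric.ball x₀ 2, DifferentiableAt ℝ p₂ x ∧
          ‖fderiv ℝ p₂ x‖ ≤ c₀ * ∫ y in (Metric.ball x₀ 3)ᶜ, ‖w y‖ ^ 2 / ‖y - x₀‖ ^ 4) ∧
      ∀ r : ℝ, 1 ≤ r →
        ‖(∫ x, ((⟨1, 2, zero_lt_one, one_lt_two⟩ : ContDiffBump (0 : EuclideanSpace ℝ (Fin 3))) :
              EuclideanSpace ℝ (Fin 3) → ℝ) (r⁻¹ • x))⁻¹ •
            (∫ x, (((⟨1, 2, zero_lt_one, one_lt_two⟩ :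
                ContDiffBump (0 : EuclideanSpace ℝ (Fin 3))) : EuclideanSpace ℝ (Fin 3) → ℝ)
                  (r⁻¹ • x)) • gradient q x) - a‖ ≤ c₀ * M ^ 2 / r := by
  sorry

/-- stub PIN `stub_fplPinning` (M): the affine pressure mode vanishes. If the scale-`r` bump
averages of `∇p(τ,·)` converge to `a(τ)` at rate `κ(τ)/r` with `κ` locally bounded on the window,
and the mean displacement of `u` vanishes, then `a ≡ 0` on the window: average the momentum
equation `∇p = Δu − (u·∇)u − ∂ₜu` against `θ_r/∫θ_r`, integrate over `[t₁, t₂]`; the viscous and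
transport terms are `O(‖u‖_∞/r²)`, `O(‖u‖²_∞/r)` after integrating by parts onto `θ_r`, the
time-derivative term is the mean displacement; so `∫_{t₁}^{t₂} a = 0` for all `t₁ < t₂`, and `a`
is continuous (uniform limit of continuous averages). -/
theorem stub_fplPinning :
    ∀ (C : ℝ) (u : ℝ → EuclideanSpace ℝ (Fin 3) → EuclideanSpace ℝ (Fin 3)),
    Literature.Analysis.FluidPDE.IsTypeIAncientMild C u →
    ∀ (t₀ : ℝ) (p : ℝ → EuclideanSpace ℝ (Fin 3) → ℝ),
    Literature.Analysis.FluidPDE.IsClassicalNSSolutionOn (Set.Ioo t₀ 0) 1 0 u p →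
    ∀ (a : ℝ → EuclideanSpace ℝ (Fin 3)) (κ : ℝ → ℝ),
    (∀ τ ∈ Set.Ioo t₀ 0, ∀ r : ℝ, 1 ≤ r →
      ‖(∫ x, ((⟨1, 2, zero_lt_one, one_lt_two⟩ : ContDiffBump (0 : EuclideanSpace ℝ (Fin 3))) :
            EuclideanSpace ℝ (Fin 3) → ℝ) (r⁻¹ • x))⁻¹ •
          (∫ x, (((⟨1, 2, zero_lt_one, one_lt_two⟩ :
              ContDiffBump (0 : EuclideanSpace ℝ (Fin 3))) : EuclideanSpace ℝ (Fin 3) → ℝ)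
                (r⁻¹ • x)) • gradient (p τ) x) - a τ‖ ≤ κ τ / r) →
    (∀ τ₁ τ₂ : ℝ, t₀ < τ₁ → τ₂ < 0 → ∃ K : ℝ, ∀ τ ∈ Set.Icc τ₁ τ₂, κ τ ≤ K) →
    (∀ t₁ t₂ : ℝ, t₁ < t₂ → t₂ < 0 →
      Filter.Tendsto (fun r : ℝ => (r ^ 3)⁻¹ •
        ∫ x, (((⟨1, 2, zero_lt_one, one_lt_two⟩ : ContDiffBump (0 : EuclideanSpace ℝ (Fin 3))) :
            EuclideanSpace ℝ (Fin 3) → ℝ) (r⁻¹ • x)) • (u t₂ x - u t₁ x))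
        Filter.atTop (nhds 0)) →
    ∀ τ ∈ Set.Ioo t₀ 0, a τ = 0 := by
  sorry

/-! ## Composition (sorry-free) -/

/-! ### 1. The pressure block: near/far structure on every window -/

/-- From HA + GRADP + PIN + MD (+ the tree's classical pair on windows and pressure Poisson
equation): every `u ∈ A_C` has, on every window `(t₀, 0)`, a classical pressure with the near/far
structure at unit scale, constant `c₀` of HA. -/
theorem nearFar_window {c₀ : ℝ}
    (hHA : ∀ (M L : ℝ) (w : ℝ³ → ℝ³) (q : ℝ³ → ℝ),
      ContDiff ℝ (⊤ : ℕ∞) w → ContDiff ℝ (⊤ : ℕ∞) q → VectorCalculus.IsDivFree w →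
      (∀ x, ‖w x‖ ≤ M) → (∀ x, ‖fderiv ℝ q x‖ ≤ L) →
      (∀ x, Laplacian.laplacian q x = -VectorCalculus.divergence (convect w w) x) →
      ∃ a : ℝ³,
        (∀ x₀ : ℝ³, ∃ (c : ℝ) (p₁ p₂ : ℝ³ → ℝ),
          (∀ x ∈ ball x₀ 2, q x = c + inner ℝ a x + p₁ x + p₂ x) ∧ MemLp p₁ 2 volume ∧
          ∫ x, p₁ x ^ 2 ≤ c₀ * M ^ 2 * ∫ x in ball x₀ 4, ‖w x‖ ^ 2 ∧
          ∀ x ∈ ball x₀ 2, DifferentiableAt ℝ p₂ x ∧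
            ‖fderiv ℝ p₂ x‖ ≤ c₀ * ∫ y in (ball x₀ 3)ᶜ, ‖w y‖ ^ 2 / ‖y - x₀‖ ^ 4) ∧
        ∀ r : ℝ, 1 ≤ r →
          ‖(∫ x, bump (r⁻¹ • x))⁻¹ • (∫ x, (bump (r⁻¹ • x)) • gradient q x) - a‖ ≤ c₀ * M ^ 2 / r)
    (hc₀ : 0 ≤ c₀) {C : ℝ} {u : ℝ → ℝ³ → ℝ³} (hu : IsTypeIAncientMild C u) {t₀ : ℝ} (ht₀ : t₀ < 0) :
    ∃ p : ℝ → ℝ³ → ℝ, IsClassicalNSSolutionOn (Ioo t₀ 0) 1 0 u p ∧ NearFar c₀ C u p t₀ := by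
  obtain ⟨p, hp⟩ := hu.exists_isClassicalNSSolutionOn_Ioo ht₀
  refine ⟨p, hp, ?_⟩
  -- the slice lemma at every window time, with `M = C/√(-τ)`
  have hslice : ∀ τ ∈ Ioo t₀ 0, ∃ a : ℝ³,
      (∀ x₀ : ℝ³, ∃ (c : ℝ) (p₁ p₂ : ℝ³ → ℝ),
        (∀ x ∈ ball x₀ 2, p τ x = c + inner ℝ a x + p₁ x + p₂ x) ∧ MemLp p₁ 2 volume ∧
        ∫ x, p₁ x ^ 2 ≤ c₀ * (C / Real.sqrt (-τ)) ^ 2 * ∫ x in ball x₀ 4, ‖u τ x‖ ^ 2 ∧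
        ∀ x ∈ ball x₀ 2, DifferentiableAt ℝ p₂ x ∧
          ‖fderiv ℝ p₂ x‖ ≤ c₀ * ∫ y in (ball x₀ 3)ᶜ, ‖u τ y‖ ^ 2 / ‖y - x₀‖ ^ 4) ∧
      ∀ r : ℝ, 1 ≤ r →
        ‖(∫ x, bump (r⁻¹ • x))⁻¹ • (∫ x, (bump (r⁻¹ • x)) • gradient (p τ) x) - a‖ ≤
          c₀ * (C / Real.sqrt (-τ)) ^ 2 / r := by
    intro τ hτ
    have hτ0 : τ < 0 := hτ.2
    obtain ⟨L, hL⟩ := stub_fplPressureGradientBound C u hu t₀ p hp τ hτ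
    refine hHA (C / Real.sqrt (-τ)) L (u τ) (p τ) (hu.contDiff_slice hτ0) (hp.contDiff_pressure hτ)
      (hu.isDivFree hτ0) (fun x => hu.norm_le hτ0 x) hL fun x => ?_
    have hint : τ ∈ interior (Ioo t₀ 0) := by rw [isOpen_Ioo.interior_eq]; exact hτ
    have key := laplacian_pressure_eq_of_isClassicalNSSolutionOn hp hint x
    simpa [VectorCalculus.divergence] using key
  choose! a ha using hslice
  -- pinning: the affine mode vanishes
  have hpin : ∀ τ ∈ Ioo t₀ 0, a τ = 0 := by
    refine stub_fplPinning C u hu t₀ p hp a (fun τ => c₀ * (C / Real.sqrt (-τ)) ^ 2)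
      (fun τ hτ r hr => (ha τ hτ).2 r hr) (fun τ₁ τ₂ _ h₂ => ?_) (stub_fplMeanDisplacement C u hu)
    refine ⟨c₀ * (C ^ 2 / (-τ₂)), fun τ hτ => ?_⟩
    have hτ0 : τ < 0 := lt_of_le_of_lt hτ.2 h₂
    have e : (C / Real.sqrt (-τ)) ^ 2 = C ^ 2 / (-τ) := by
      rw [div_pow, Real.sq_sqrt (by linarith)]
    rw [e]
    refine mul_le_mul_of_nonneg_left ?_ hc₀
    exact div_le_div_of_nonneg_left (sq_nonneg C) (by linarith) (by linarith [hτ.2])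
  -- assemble
  intro τ hτ x₀
  obtain ⟨c, p₁, p₂, hdec, hmem, hnear, hfar⟩ := (ha τ hτ).1 x₀
  refine ⟨c, p₁, p₂, fun x hx => ?_, hmem, ?_, hfar⟩
  · rw [hdec x hx, hpin τ hτ, inner_zero_left, add_zero]
  · have e : (C / Real.sqrt (-τ)) ^ 2 = C ^ 2 / (-τ) := by
      rw [div_pow, Real.sq_sqrt (by linarith [hτ.2])]
    rw [← e]
    exact hnear

/-! ### 2. The closure: doubling Grönwall on the unit window -/

/-- Type-I bound on unit balls: `∫_{B₁(z)} ‖u(τ)‖² ≤ C²/(−τ) · |B₁|`. -/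
theorem energy_unitBall_le_typeI {C : ℝ} {u : ℝ → ℝ³ → ℝ³} (hu : IsTypeIAncientMild C u) {τ : ℝ}
    (hτ : τ < 0) (z : ℝ³) :
    ∫ x in ball z 1, ‖u τ x‖ ^ 2 ≤ C ^ 2 / (-τ) * (volume (ball (0 : ℝ³) 1)).toReal := by
  have hpt : ∀ x, ‖u τ x‖ ^ 2 ≤ C ^ 2 / (-τ) := fun x => by
    have h1 := hu.norm_le hτ x
    have h2 : (C / Real.sqrt (-τ)) ^ 2 = C ^ 2 / (-τ) := by
      rw [div_pow, Real.sq_sqrt (by linarith)]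
    rw [← h2]
    exact pow_le_pow_left₀ (norm_nonneg _) h1 2
  calc ∫ x in ball z 1, ‖u τ x‖ ^ 2 ≤ ∫ _x in ball z 1, C ^ 2 / (-τ) :=
        integral_mono_of_nonneg (Eventually.of_forall fun x => by positivity)
          (integrableOn_const measure_ball_lt_top.ne) (Eventually.of_forall hpt)
    _ = C ^ 2 / (-τ) * (volume (ball (0 : ℝ³) 1)).toReal := by
        rw [setIntegral_const, smul_eq_mul, measureReal_def, mul_comm,
          Measure.addHaar_ball_center volume z 1]

/-- `√x − √y ≤ √(x − y)` for `0 ≤ y ≤ x`. -/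
theorem sqrt_sub_sqrt_le {x y : ℝ} (hy : 0 ≤ y) (hxy : y ≤ x) :
    Real.sqrt x - Real.sqrt y ≤ Real.sqrt (x - y) := by
  rw [sub_le_iff_le_add]
  have hx : 0 ≤ x := hy.trans hxy
  have h1 : 0 ≤ Real.sqrt (x - y) := Real.sqrt_nonneg _
  have h2 : 0 ≤ Real.sqrt y := Real.sqrt_nonneg _
  rw [Real.sqrt_le_left (by positivity)]
  nlinarith [Real.sq_sqrt (sub_nonneg.2 hxy), Real.sq_sqrt hy, mul_nonneg h1 h2]

/-- Absorption: if every element of a nonempty bounded set is `≤ A + sup/2` then `sup ≤ 2A`. -/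
theorem csSup_le_two_mul {T : Set ℝ} (hne : T.Nonempty) {A : ℝ}
    (h : ∀ x ∈ T, x ≤ A + sSup T / 2) : sSup T ≤ 2 * A := by
  have := csSup_le hne h
  linarith

/-- ONE DOUBLING STEP. On a window time interval `[a, b] ⊂ (−2, 0)` on which the ledger
coefficient satisfies `N((b−a) + C(√(−a) − √(−b))) ≤ 1/2`, a bound `F` for the unit-ball energies
at time `a` propagates as `2NF` to all of `[a, b]` (sup over the interval absorbed). -/
theorem doubling_step {C N : ℝ} (hN : 0 ≤ N) (hC : 0 ≤ C) {u : ℝ → ℝ³ → ℝ³}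
    (hLu : ∀ (s' t' : ℝ), -2 < s' → s' ≤ t' → t' < 0 → ∀ (F₀ B : ℝ), 0 ≤ B →
      (∀ z : ℝ³, ∫ x in ball z 1, ‖u s' x‖ ^ 2 ≤ F₀) →
      (∀ τ ∈ Icc s' t', ∀ z : ℝ³, ∫ x in ball z 1, ‖u τ x‖ ^ 2 ≤ B) →
      ∀ x₀ : ℝ³, ∫ x in ball x₀ 1, ‖u t' x‖ ^ 2 ≤
        N * F₀ + N * B * ((t' - s') + C * (Real.sqrt (-s') - Real.sqrt (-t'))))
    {a b : ℝ} (hab : a ≤ b) (ha : -2 < a) (hb : b < 0)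
    (hμ : N * ((b - a) + C * (Real.sqrt (-a) - Real.sqrt (-b))) ≤ 1 / 2)
    {B₀ : ℝ} (hB₀ : ∀ τ ∈ Icc a b, ∀ z : ℝ³, ∫ x in ball z 1, ‖u τ x‖ ^ 2 ≤ B₀)
    {F : ℝ} (hF : ∀ z : ℝ³, ∫ x in ball z 1, ‖u a x‖ ^ 2 ≤ F) :
    ∀ τ ∈ Icc a b, ∀ z : ℝ³, ∫ x in ball z 1, ‖u τ x‖ ^ 2 ≤ 2 * N * F := by
  set E : ℝ → ℝ³ → ℝ := fun τ z => ∫ x in ball z 1, ‖u τ x‖ ^ 2 with hE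
  set T : Set ℝ := (fun q : ℝ × ℝ³ => E q.1 q.2) '' (Icc a b ×ˢ univ) with hT
  have hne : T.Nonempty := ⟨E a 0, ⟨(a, 0), ⟨⟨le_rfl, hab⟩, mem_univ _⟩, rfl⟩⟩
  have hbdd : BddAbove T := by
    refine ⟨B₀, ?_⟩
    rintro _ ⟨⟨τ, z⟩, ⟨hτ, -⟩, rfl⟩
    exact hB₀ τ hτ z
  have hmem : ∀ τ ∈ Icc a b, ∀ z : ℝ³, E τ z ∈ T := fun τ hτ z => ⟨(τ, z), ⟨hτ, mem_univ _⟩, rfl⟩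
  have hle : ∀ τ ∈ Icc a b, ∀ z : ℝ³, E τ z ≤ sSup T := fun τ hτ z => le_csSup hbdd (hmem τ hτ z)
  have hS0 : 0 ≤ sSup T := by
    refine le_trans ?_ (hle a ⟨le_rfl, hab⟩ 0)
    exact integral_nonneg fun x => by positivity
  -- every energy on the interval is `≤ N F + sup/2`
  have key : ∀ x ∈ T, x ≤ N * F + sSup T / 2 := by
    rintro _ ⟨⟨τ, z⟩, ⟨hτ, -⟩, rfl⟩
    have hτ0 : τ < 0 := lt_of_le_of_lt hτ.2 hb
    have h1 := hLu a τ ha hτ.1 hτ0 F (sSup T) hS0 hF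
      (fun τ' hτ' z' => hle τ' ⟨hτ'.1, hτ'.2.trans hτ.2⟩ z') z
    have hcoef : (τ - a) + C * (Real.sqrt (-a) - Real.sqrt (-τ)) ≤
        (b - a) + C * (Real.sqrt (-a) - Real.sqrt (-b)) := by
      have : Real.sqrt (-b) ≤ Real.sqrt (-τ) := Real.sqrt_le_sqrt (by linarith [hτ.2])
      nlinarith [hτ.2]
    have h2 : N * sSup T * ((τ - a) + C * (Real.sqrt (-a) - Real.sqrt (-τ))) ≤ sSup T / 2 := by
      calc N * sSup T * ((τ - a) + C * (Real.sqrt (-a) - Real.sqrt (-τ)))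
          ≤ N * sSup T * ((b - a) + C * (Real.sqrt (-a) - Real.sqrt (-b))) :=
            mul_le_mul_of_nonneg_left hcoef (mul_nonneg hN hS0)
        _ = sSup T * (N * ((b - a) + C * (Real.sqrt (-a) - Real.sqrt (-b)))) := by ring
        _ ≤ sSup T * (1 / 2) := mul_le_mul_of_nonneg_left hμ hS0
        _ = sSup T / 2 := by ring
    show E τ z ≤ N * F + sSup T / 2
    exact h1.trans (by linarith)
  have hsup : sSup T ≤ 2 * (N * F) := csSup_le_two_mul hne key
  intro τ hτ z
  exact (hle τ hτ z).trans (by linarith)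

/-- From LFL (with COV, SHELL discharged) and the pressure block: the unit-window ledger. -/
theorem unitWindow_of_ledger {c₀ N : ℝ} (hN : 0 ≤ N)
    (hNF : ∀ (C : ℝ) (u : ℝ → ℝ³ → ℝ³), IsTypeIAncientMild C u → ∀ t₀ < (0 : ℝ),
      ∃ p : ℝ → ℝ³ → ℝ, IsClassicalNSSolutionOn (Ioo t₀ 0) 1 0 u p ∧ NearFar c₀ C u p t₀)
    (hL : ∀ (C : ℝ) (u : ℝ → ℝ³ → ℝ³), IsTypeIAncientMild C u → ∀ (t₀ : ℝ) (p : ℝ → ℝ³ → ℝ),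
      IsClassicalNSSolutionOn (Ioo t₀ 0) 1 0 u p → NearFar c₀ C u p t₀ →
      ∀ (s' t' : ℝ), t₀ < s' → s' ≤ t' → t' < 0 → ∀ (F₀ B : ℝ), 0 ≤ B →
      (∀ z : ℝ³, ∫ x in ball z 1, ‖u s' x‖ ^ 2 ≤ F₀) →
      (∀ τ ∈ Icc s' t', ∀ z : ℝ³, ∫ x in ball z 1, ‖u τ x‖ ^ 2 ≤ B) →
      ∀ x₀ : ℝ³, ∫ x in ball x₀ 1, ‖u t' x‖ ^ 2 ≤
        N * F₀ + N * B * ((t' - s') + C * (Real.sqrt (-s') - Real.sqrt (-t')))) :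
    UnitWindowLedger := by
  intro C
  set V : ℝ := (volume (ball (0 : ℝ³) 1)).toReal with hV
  set n : ℕ := ⌈4 * N + 16 * N ^ 2 * C ^ 2 + 1⌉₊ with hn
  refine ⟨(2 * N + 1) ^ n * (C ^ 2 * V), fun u hu t ht => ?_⟩
  have hC : 0 ≤ C := hu.nonneg
  have hV0 : 0 ≤ V := ENNReal.toReal_nonneg
  have hCV : 0 ≤ C ^ 2 * V := by positivity
  have h2N1 : (1 : ℝ) ≤ 2 * N + 1 := by linarith
  obtain ⟨p, hp, hNFp⟩ := hNF C u hu (-2) (by norm_num)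
  have hLu : ∀ (s' t' : ℝ), -2 < s' → s' ≤ t' → t' < 0 → ∀ (F₀ B : ℝ), 0 ≤ B →
      (∀ z : ℝ³, ∫ x in ball z 1, ‖u s' x‖ ^ 2 ≤ F₀) →
      (∀ τ ∈ Icc s' t', ∀ z : ℝ³, ∫ x in ball z 1, ‖u τ x‖ ^ 2 ≤ B) →
      ∀ x₀ : ℝ³, ∫ x in ball x₀ 1, ‖u t' x‖ ^ 2 ≤
        N * F₀ + N * B * ((t' - s') + C * (Real.sqrt (-s') - Real.sqrt (-t'))) :=
    fun s' t' hs hst ht' F₀ B hB hF hBB x₀ =>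
      hL C u hu (-2) p hp hNFp s' t' hs hst ht' F₀ B hB hF hBB x₀
  -- the number of steps
  have hn1 : (4 * N + 16 * N ^ 2 * C ^ 2 + 1 : ℝ) ≤ n := Nat.le_ceil _
  have hNC2 : 0 ≤ 16 * N ^ 2 * C ^ 2 := by positivity
  have hnpos : (0 : ℝ) < n := by linarith
  have hn4N : 4 * N ≤ (n : ℝ) := by linarith
  have hn16 : 16 * N ^ 2 * C ^ 2 ≤ (n : ℝ) := by linarith
  -- the step
  set h : ℝ := (t + 1) / n with hh
  have ht1 : 0 < t + 1 := by linarith [ht.1]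
  have hh0 : 0 < h := div_pos ht1 hnpos
  have hh1 : h ≤ 1 / n := div_le_div_of_nonneg_right (by linarith [ht.2]) hnpos.le
  have hNh : N * h ≤ 1 / 4 := by
    calc N * h ≤ N * (1 / n) := mul_le_mul_of_nonneg_left hh1 hN
      _ = (4 * N) / n / 4 := by ring
      _ ≤ (n : ℝ) / n / 4 := by gcongr
      _ = 1 / 4 := by rw [div_self hnpos.ne']
  have hNCh : N * (C * Real.sqrt h) ≤ 1 / 4 := by
    have hsq : Real.sqrt h ≤ 1 / Real.sqrt n := by
      rw [← Real.sqrt_one, ← Real.sqrt_div zero_le_one] ; exact Real.sqrt_le_sqrt (by simpa using hh1)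
    have hsn : 0 < Real.sqrt n := Real.sqrt_pos.2 hnpos
    have h4 : 4 * N * C ≤ Real.sqrt n := by
      have h0 : 0 ≤ 4 * N * C := by positivity
      rw [show 4 * N * C = Real.sqrt ((4 * N * C) ^ 2) by rw [Real.sqrt_sq h0]]
      exact Real.sqrt_le_sqrt (by nlinarith)
    calc N * (C * Real.sqrt h) ≤ N * (C * (1 / Real.sqrt n)) := by gcongr
      _ = (4 * N * C) / Real.sqrt n / 4 := by ring
      _ ≤ Real.sqrt n / Real.sqrt n / 4 := by gcongr
      _ = 1 / 4 := by rw [div_self hsn.ne']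
  -- the grid `tg i = -1 + i h`, `tg 0 = -1`, `tg n = t`
  set tg : ℕ → ℝ := fun i => -1 + i * h with htg
  have htg0 : tg 0 = -1 := by simp [htg]
  have htgn : tg n = t := by
    simp only [htg, hh]
    field_simp
    ring
  have htg_succ : ∀ i, tg (i + 1) = tg i + h := by
    intro i; simp only [htg]; push_cast; ring
  have htg_ge : ∀ i, -1 ≤ tg i := fun i => by
    simp only [htg]; nlinarith [hh0.le, (Nat.cast_nonneg i : (0 : ℝ) ≤ i)]
  have htg_le : ∀ i, i ≤ n → tg i ≤ t := by
    intro i hi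
    have : (i : ℝ) * h ≤ n * h := mul_le_mul_of_nonneg_right (Nat.cast_le.2 hi) hh0.le
    rw [← htgn]; simp only [htg]; linarith
  -- the ledger coefficient on one step is `≤ 1/2`
  have hμ : ∀ i, i + 1 ≤ n →
      N * ((tg (i + 1) - tg i) + C * (Real.sqrt (-tg i) - Real.sqrt (-tg (i + 1)))) ≤ 1 / 2 := by
    intro i hi
    have e1 : tg (i + 1) - tg i = h := by rw [htg_succ]; ring
    have hneg : 0 ≤ -tg (i + 1) := by linarith [htg_le (i + 1) hi, ht.2]
    have hsq : Real.sqrt (-tg i) - Real.sqrt (-tg (i + 1)) ≤ Real.sqrt h := by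
      have key := sqrt_sub_sqrt_le (x := -tg i) (y := -tg (i + 1)) hneg (by rw [htg_succ]; linarith)
      rwa [show -tg i - -tg (i + 1) = h by rw [htg_succ]; ring] at key
    calc N * ((tg (i + 1) - tg i) + C * (Real.sqrt (-tg i) - Real.sqrt (-tg (i + 1))))
        = N * h + N * (C * (Real.sqrt (-tg i) - Real.sqrt (-tg (i + 1)))) := by rw [e1]; ring
      _ ≤ N * h + N * (C * Real.sqrt h) := by gcongr
      _ ≤ 1 / 4 + 1 / 4 := add_le_add hNh hNCh
      _ = 1 / 2 := by norm_num
  -- a priori (Type I) bound on `[-1, t]`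
  have hB₀ : ∀ τ ∈ Icc (-1 : ℝ) t, ∀ z : ℝ³, ∫ x in ball z 1, ‖u τ x‖ ^ 2 ≤ C ^ 2 / (-t) * V := by
    intro τ hτ z
    have hτ0 : τ < 0 := lt_of_le_of_lt hτ.2 ht.2
    refine (energy_unitBall_le_typeI hu hτ0 z).trans ?_
    refine mul_le_mul_of_nonneg_right ?_ hV0
    exact div_le_div_of_nonneg_left (sq_nonneg C) (by linarith [ht.2]) (by linarith [hτ.2])
  -- induction over the grid
  have main : ∀ i : ℕ, i ≤ n → ∀ τ ∈ Icc (-1 : ℝ) (tg i), ∀ z : ℝ³,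
      ∫ x in ball z 1, ‖u τ x‖ ^ 2 ≤ (2 * N + 1) ^ i * (C ^ 2 * V) := by
    intro i
    induction i with
    | zero =>
      intro _ τ hτ z
      rw [htg0] at hτ
      have hτ1 : τ = -1 := le_antisymm hτ.2 hτ.1
      subst hτ1
      have key := energy_unitBall_le_typeI hu (τ := -1) (by norm_num) z
      simp only [neg_neg, div_one, pow_zero, one_mul] at key ⊢
      exact key
    | succ i ih =>
      intro hi τ hτ z
      have hi' : i ≤ n := Nat.le_of_succ_le hi
      have ih' := ih hi'
      have hpow : (2 * N + 1) ^ i * (C ^ 2 * V) ≤ (2 * N + 1) ^ (i + 1) * (C ^ 2 * V) :=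
        mul_le_mul_of_nonneg_right (pow_le_pow_right₀ h2N1 (Nat.le_succ i)) hCV
      rcases le_or_gt τ (tg i) with h1 | h1
      · exact (ih' τ ⟨hτ.1, h1⟩ z).trans hpow
      · have hab : tg i ≤ tg (i + 1) := by rw [htg_succ]; linarith
        have ha : -2 < tg i := by linarith [htg_ge i]
        have hb : tg (i + 1) < 0 := lt_of_le_of_lt (htg_le (i + 1) hi) ht.2
        have hF : ∀ z : ℝ³, ∫ x in ball z 1, ‖u (tg i) x‖ ^ 2 ≤ (2 * N + 1) ^ i * (C ^ 2 * V) :=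
          fun z => ih' (tg i) ⟨htg_ge i, le_rfl⟩ z
        have hB₀' : ∀ τ' ∈ Icc (tg i) (tg (i + 1)), ∀ z : ℝ³,
            ∫ x in ball z 1, ‖u τ' x‖ ^ 2 ≤ C ^ 2 / (-t) * V :=
          fun τ' hτ' z => hB₀ τ' ⟨(htg_ge i).trans hτ'.1, hτ'.2.trans (htg_le (i + 1) hi)⟩ z
        have hstep := doubling_step hN hC hLu hab ha hb (hμ i hi) hB₀' hF τ ⟨h1.le, hτ.2⟩ z
        refine hstep.trans ?_
        calc 2 * N * ((2 * N + 1) ^ i * (C ^ 2 * V))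
            ≤ (2 * N + 1) * ((2 * N + 1) ^ i * (C ^ 2 * V)) :=
              mul_le_mul_of_nonneg_right (by linarith) (by positivity)
          _ = (2 * N + 1) ^ (i + 1) * (C ^ 2 * V) := by ring
  exact main n le_rfl t ⟨by linarith [ht.1], by rw [htgn]⟩ 0

/-! ### 3. The reduction to the unit window (scaling and translation invariance of `A_C`) -/

/-- **`A_C` is invariant under the parabolic scaling** `u ↦ c u(c²t, cx)`, `c > 0`
(adapted from `Cruxes/FarPastLedger/Disproof.lean` §6, `isTypeIAncientMild_nsRescale`). -/
theorem isTypeIAncientMild_nsRescale {C : ℝ} {u : ℝ → ℝ³ → ℝ³} (h : IsTypeIAncientMild C u) {c : ℝ}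
    (hc : 0 < c) : IsTypeIAncientMild C (nsRescale c u) := by
  have hc2 : 0 < c ^ 2 := pow_pos hc 2
  refine ⟨?_, fun t ht => ?_, fun s t hst ht x => ?_, h.hasTypeITimeDecay.nsRescale hc⟩
  · have e : Function.uncurry (nsRescale c u) =
        fun p : ℝ × ℝ³ => c • Function.uncurry u (c ^ 2 * p.1, c • p.2) := by
      funext p; rfl
    rw [e]
    refine (h.contDiffOn.comp
      ((contDiff_const.mul contDiff_fst).prodMk (contDiff_snd.const_smul c)).contDiffOn
      fun p hp => ?_).const_smul c
    have hp1 : p.1 < 0 := hp.1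
    exact mk_mem_prod (mul_neg_of_pos_of_neg hc2 hp1) (mem_univ _)
  · have hct : c ^ 2 * t < 0 := mul_neg_of_pos_of_neg hc2 ht
    have hd : VectorCalculus.IsDivFree (fun x : ℝ³ => u (c ^ 2 * t) (c • x)) :=
      (h.isDivFree hct).comp_smul c
    have hdiff : Differentiable ℝ (fun x : ℝ³ => u (c ^ 2 * t) (c • x)) :=
      ((h.contDiff_slice hct).differentiable (by simp)).comp (differentiable_id.const_smul c)
    intro x
    have e : nsRescale c u t = fun y => c • (fun z : ℝ³ => u (c ^ 2 * t) (c • z)) y := rfl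
    rw [e]
    simp only [VectorCalculus.divergence, fderiv_fun_const_smul (hdiff x) c,
      ContinuousLinearMap.toLinearMap_smul, map_smul, smul_eq_mul]
    have key := hd x
    simp only [VectorCalculus.divergence] at key
    rw [key, mul_zero]
  · have hst' : (0 : ℝ) + c ^ 2 * s < 0 + c ^ 2 * t := by nlinarith
    have ht' : (0 : ℝ) + c ^ 2 * t < 0 := by nlinarith
    have hu : ∀ X, u (0 + c ^ 2 * t) X = heatExtension (u (0 + c ^ 2 * s)) (0 + c ^ 2 * t - (0 + c ^ 2 * s)) X -
        oseenDuhamel 1 (0 + c ^ 2 * s) u u (0 + c ^ 2 * t) X :=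
      fun X => h.mild_eq_heatExtension hst' ht' X
    have key := oseen_smul_stPull hc 0 (0 : ℝ³) hst hu x
    have e2 : nsRescale c u = c • stPull (c ^ 2) c 0 0 u := by
      funext s' y
      simp only [nsRescale_apply, Pi.smul_apply, stPull_apply, zero_add]
    rw [e2, heatFlow_of_pos _ (sub_pos.2 hst)]
    exact key

/-- Scaling law of the local energy: `∫_{B_R(x₀)} |u_c(t)|² = c⁻¹ ∫_{B_{cR}(cx₀)} |u(c²t)|²`
(adapted from `Disproof.lean` §6). -/
theorem setIntegral_ball_nsRescale {c : ℝ} (hc : 0 < c) (u : ℝ → ℝ³ → ℝ³) (t : ℝ) (x₀ : ℝ³) (R : ℝ) :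
    ∫ x in ball x₀ R, ‖nsRescale c u t x‖ ^ 2 =
      c⁻¹ * ∫ y in ball (c • x₀) (c * R), ‖u (c ^ 2 * t) y‖ ^ 2 := by
  have e : ∀ x, ‖nsRescale c u t x‖ ^ 2 = c ^ 2 * (fun y => ‖u (c ^ 2 * t) y‖ ^ 2) (c • x) := fun x => by
    simp only [nsRescale_apply, norm_smul, Real.norm_of_nonneg hc.le, mul_pow]
  simp_rw [e]
  rw [integral_const_mul, Measure.setIntegral_comp_smul_of_pos volume (fun y => ‖u (c ^ 2 * t) y‖ ^ 2)
    (ball x₀ R) hc, smul_ball hc.ne' x₀ R, Real.norm_of_nonneg hc.le, finrank_euclideanSpace_fin, smul_eq_mul]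
  field_simp

/-- **`A_C` is invariant under spatial translations** (adapted from `Disproof.lean` §6). -/
theorem isTypeIAncientMild_translate {C : ℝ} {u : ℝ → ℝ³ → ℝ³} (h : IsTypeIAncientMild C u) (x₀ : ℝ³) :
    IsTypeIAncientMild C (fun t x => u t (x₀ + x)) := by
  refine ⟨?_, fun t ht => ?_, fun s t hst ht x => ?_, fun t ht x => h.norm_le ht _⟩
  · have e : Function.uncurry (fun t x => u t (x₀ + x)) =
        fun p : ℝ × ℝ³ => Function.uncurry u (p.1, x₀ + p.2) := by
      funext p; rfl
    rw [e]
    exact h.contDiffOn.comp (contDiff_fst.prodMk (contDiff_const.add contDiff_snd)).contDiffOn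
      fun p hp => mk_mem_prod hp.1 (mem_univ _)
  · intro x
    have key := h.isDivFree ht (x₀ + x)
    simp only [VectorCalculus.divergence] at key ⊢
    rw [fderiv_comp_add_left]
    exact key
  · have hu : ∀ X, u (0 + (1 : ℝ) ^ 2 * t) X =
        heatExtension (u (0 + (1 : ℝ) ^ 2 * s)) (0 + (1 : ℝ) ^ 2 * t - (0 + (1 : ℝ) ^ 2 * s)) X -
          oseenDuhamel 1 (0 + (1 : ℝ) ^ 2 * s) u u (0 + (1 : ℝ) ^ 2 * t) X := by
      intro X
      simpa using h.mild_eq_heatExtension hst ht X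
    have key := oseen_smul_stPull one_pos 0 x₀ hst hu x
    have e2 : (fun t x => u t (x₀ + x)) = (1 : ℝ) • stPull ((1 : ℝ) ^ 2) 1 0 x₀ u := by
      funext s' y
      simp only [Pi.smul_apply, stPull_apply, one_pow, one_mul, zero_add, one_smul]
    rw [e2, heatFlow_of_pos _ (sub_pos.2 hst)]
    exact key

/-- Translation of the local energy: `∫_{B_R(0)} |u(t, x₀ + y)|² dy = ∫_{B_R(x₀)} |u(t)|²`. -/
theorem setIntegral_ball_translate (u : ℝ → ℝ³ → ℝ³) (t : ℝ) (x₀ : ℝ³) (R : ℝ) :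
    ∫ y in ball (0 : ℝ³) R, ‖u t (x₀ + y)‖ ^ 2 = ∫ y in ball x₀ R, ‖u t y‖ ^ 2 := by
  rw [← integral_indicator measurableSet_ball, ← integral_indicator measurableSet_ball]
  have e : (ball (0 : ℝ³) R).indicator (fun y => ‖u t (x₀ + y)‖ ^ 2) =
      fun y => (ball x₀ R).indicator (fun y => ‖u t y‖ ^ 2) (x₀ + y) := by
    funext y
    by_cases hy : y ∈ ball (0 : ℝ³) R
    · have hy' : x₀ + y ∈ ball x₀ R := by simpa [mem_ball, dist_eq_norm] using hy
      simp [Set.indicator, hy, hy']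
    · have hy' : x₀ + y ∉ ball x₀ R := by simpa [mem_ball, dist_eq_norm] using hy
      simp [Set.indicator, hy, hy']
  rw [e, integral_add_left_eq_self]

/-- **Reduction**: the unit-window ledger implies the crux (scale by `R`, translate by `x₀`; for
`t/R² ≤ −1` the unit ball lies in the parabolic interior where Type I alone gives `C²|B₁|`). -/
theorem crux_of_unitWindow (h : UnitWindowLedger) :
    Summit.NavierStokesRegularity.NavierStokesRegularity.Theses.SymmetryModuliCount.FarPastLedger := by
  intro C
  obtain ⟨K, hK⟩ := h C
  -- Step 1: unit ball at the origin, all `t < 0` (Type I for `t ≤ -1`).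
  set V : ℝ := (volume (ball (0 : ℝ³) 1)).toReal with hV
  set K₁ : ℝ := max K (C ^ 2 * V) with hK₁
  have h1 : ∀ (u : ℝ → ℝ³ → ℝ³), IsTypeIAncientMild C u → ∀ t < 0,
      ∫ x in ball (0 : ℝ³) 1, ‖u t x‖ ^ 2 ≤ K₁ := by
    intro u hu t ht
    rcases lt_or_ge (-1 : ℝ) t with h1 | h1
    · exact (hK u hu t ⟨h1, ht⟩).trans (le_max_left _ _)
    · refine le_trans ?_ (le_max_right _ _)
      have hpt : ∀ x, ‖u t x‖ ^ 2 ≤ C ^ 2 := fun x => by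
        have h1' := hu.norm_le ht x
        have hs1 : 1 ≤ Real.sqrt (-t) := by
          rw [← Real.sqrt_one]; exact Real.sqrt_le_sqrt (by linarith)
        have h2 : C / Real.sqrt (-t) ≤ C := div_le_self hu.nonneg hs1
        exact pow_le_pow_left₀ (norm_nonneg _) (h1'.trans h2) 2
      calc ∫ x in ball (0 : ℝ³) 1, ‖u t x‖ ^ 2 ≤ ∫ _x in ball (0 : ℝ³) 1, C ^ 2 :=
            integral_mono_of_nonneg (Eventually.of_forall fun x => by positivity)
              (integrableOn_const measure_ball_lt_top.ne) (Eventually.of_forall hpt)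
        _ = C ^ 2 * V := by
            rw [setIntegral_const, smul_eq_mul, measureReal_def, mul_comm]
  -- Step 2: all centres (translation invariance of the class).
  have h2 : ∀ (u : ℝ → ℝ³ → ℝ³), IsTypeIAncientMild C u → ∀ t < 0, ∀ x₀ : ℝ³,
      ∫ x in ball x₀ 1, ‖u t x‖ ^ 2 ≤ K₁ := by
    intro u hu t ht x₀
    have key := h1 _ (isTypeIAncientMild_translate hu x₀) t ht
    rwa [setIntegral_ball_translate u t x₀ 1] at key
  -- Step 3: all radii (scaling invariance of the class and of the ledger).
  refine ⟨K₁, fun u hu t ht x₀ R hR => ?_⟩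
  have htR : t / R ^ 2 < 0 := div_neg_of_neg_of_pos ht (pow_pos hR 2)
  have key := h2 (nsRescale R u) (isTypeIAncientMild_nsRescale hu hR) (t / R ^ 2) htR (R⁻¹ • x₀)
  have e2 : R ^ 2 * (t / R ^ 2) = t := by field_simp
  rw [setIntegral_ball_nsRescale hR, smul_smul, mul_inv_cancel₀ hR.ne', one_smul, mul_one, e2] at key
  have key' : R⁻¹ * (∫ x in ball x₀ R, ‖u t x‖ ^ 2) ≤ R⁻¹ * (K₁ * R) :=
    key.trans_eq (by field_simp)
  exact le_of_mul_le_mul_left key' (inv_pos.2 hR)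

/-! ### 4. The skeleton theorem -/

/-- THE SKELETON: the crux `SymmetryModuliCount.FarPastLedger` by name, from the seven registered
stubs (sorries only inside `stub_*`). -/
theorem FarPastLedger_of :
    Summit.NavierStokesRegularity.NavierStokesRegularity.Theses.SymmetryModuliCount.FarPastLedger := by
  obtain ⟨c₀, hc₀, hHA⟩ := stub_fplSlicePressure
  obtain ⟨cS, -, hS⟩ := stub_fplFarShell
  obtain ⟨N, hN, hL⟩ := stub_fplLinearFluxLedger c₀ cS
  refine crux_of_unitWindow (unitWindow_of_ledger (c₀ := c₀) hN ?_ ?_)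
  · intro C u hu t₀ ht₀
    exact nearFar_window hHA hc₀ hu ht₀
  · intro C u hu t₀ p hp hNF s' t' hs hst ht F₀ B hB hF hBB x₀
    exact hL C u hu t₀ p hp hNF stub_fplCovering (hS stub_fplCovering) s' t' hs hst ht F₀ B hB hF hBB x₀

end Summit.NavierStokesRegularity.NavierStokesRegularity.Cruxes.FarPastLedger.UlocGronwallTransplant

end
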